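import Literature.Probability.LatticeModels.IsoradialPercolation
import Literature.Probability.Percolation.PercolationEvents
import HarnessLib

/-!
# Crux `PercNearOneGluing.NoHeavyLowerTail` (stmt-CriticalPhenomena-4575) — Φ-SUPERHARMONICITY: definitions

Seat `prim-lf-4` (lemma factory #4, LP-duality), 2026-08-19.  The one object this memo line posits
(`run/shared/lean/prim/prim-lf-4/PHI-SH.md`): for bond percolation `μ_w = prodBernoulli w` on `Fin n`, relays `A`,
level `j`, `π(v) = {a ∈ A : v ↔ a}`,

* `PhiSuperharmonic.lightness w A j a = μ_w(|π(a)| ≤ j)` and the CHAMPION LIGHTNESS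
  `PhiSuperharmonic.phi w A hA j = max_{a ∈ A} μ_w(|π(a)| ≤ j)` (`Φ_j(w)`);
* `PhiSuperharmonic.restrictWeights w C` — the weights with every pair meeting the vertex set `C` set to `0`
  ("delete the vertices of `C`"; when `C` is the closed-boundary open cluster of a vertex and holds no relay,
  percolation off `C` is `μ_{w ∖ C}` as far as the relays are concerned);
* `PhiSuperharmonic.clusterEq u C` — the event "the open cluster of `u` is exactly `C`";
* `PhiSuperharmonic` — the statement (Φ-SH): for all `n, w`, nonempty `A`, `u ∉ A`, `j`,
  `μ_w(1 ≤ |π(u)| ≤ j) + Σ_{C : u ∈ C, C ∩ A = ∅} μ_w(cluster(u) = C) · Φ_j(w ∖ C) ≤ Φ_j(w)`.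

(Φ-SH) is a CANDIDATE (0 violations in > 20 000 exact rechecks over eleven `(|A|, j)` cells; exact equality on the
tie/glue locus); it implies the cumulative isolation lemma and hence the crux
(`Theorems/PercNearOneGluingNoHeavyLowerTailPhiSuperharmonic.lean`).  Nothing here asserts anything about the crux.
-/

noncomputable section

namespace Summit.CriticalPhenomena.PercolationContinuityZ3.Theorems

open MeasureTheory Set Literature.Probability.LatticeModels Literature.Probability.Percolation
open scoped Classical BigOperators

namespace PhiSuperharmonic

variable {n : ℕ}

/-- The lightness `μ_w(|π(a)| ≤ j)` of a vertex `a` (relays joined to `a`, `a` counted iff `a ∈ A`). [this work] -/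
def lightness (w : Sym2 (Fin n) → unitInterval) (A : Finset (Fin n)) (j : ℕ) (a : Fin n) : ℝ :=
  (prodBernoulli w).real {ω : BondConfig (Fin n) | (A.filter fun x => ω ∈ openConn a x).card ≤ j}

/-- The champion lightness `Φ_j(w) = max_{a ∈ A} μ_w(|π(a)| ≤ j)` of a nonempty relay set. [this work] -/
def phi (w : Sym2 (Fin n) → unitInterval) (A : Finset (Fin n)) (hA : A.Nonempty) (j : ℕ) : ℝ :=
  A.sup' hA (lightness w A j)

/-- The weights with every pair meeting the vertex set `C` set to zero ("delete the vertices of `C`"). [this work] -/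
def restrictWeights (w : Sym2 (Fin n) → unitInterval) (C : Finset (Fin n)) : Sym2 (Fin n) → unitInterval :=
  fun e => if ∃ v ∈ C, v ∈ e then 0 else w e

/-- The event "the open cluster of `u` is exactly the vertex set `C`". [this work] -/
def clusterEq (u : Fin n) (C : Finset (Fin n)) : Set (BondConfig (Fin n)) :=
  {ω | ∀ v : Fin n, ω ∈ openConn u v ↔ v ∈ C}

/-- Lightness is a probability, hence nonnegative. [this work] -/
theorem lightness_nonneg (w : Sym2 (Fin n) → unitInterval) (A : Finset (Fin n)) (j : ℕ) (a : Fin n) :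
    0 ≤ lightness w A j a := measureReal_nonneg

/-- The champion lightness is nonnegative. [this work] -/
theorem phi_nonneg (w : Sym2 (Fin n) → unitInterval) (A : Finset (Fin n)) (hA : A.Nonempty) (j : ℕ) :
    0 ≤ phi w A hA j := by
  obtain ⟨a, ha⟩ := hA
  exact (lightness_nonneg w A j a).trans (Finset.le_sup' (lightness w A j) ha)

/-- The champion lightness is attained at some relay (a "champion"). [this work] -/
theorem exists_eq_phi (w : Sym2 (Fin n) → unitInterval) (A : Finset (Fin n)) (hA : A.Nonempty) (j : ℕ) :
    ∃ a ∈ A, phi w A hA j = lightness w A j a :=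
  Finset.exists_mem_eq_sup' hA (lightness w A j)

/-- Every relay is at most as light as the champion. [this work] -/
theorem lightness_le_phi (w : Sym2 (Fin n) → unitInterval) (A : Finset (Fin n)) (hA : A.Nonempty) (j : ℕ)
    {a : Fin n} (ha : a ∈ A) : lightness w A j a ≤ phi w A hA j :=
  Finset.le_sup' (lightness w A j) ha

end PhiSuperharmonic

open PhiSuperharmonic in
/-- **Φ-superharmonicity** (candidate inequality of the `prim-lf-4` lemma factory; NOT proved, see the memo
`PHI-SH.md`): for every weighted graph on `Fin n`, nonempty relay set `A`, vertex `u ∉ A` and level `j`,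
`μ_w(1 ≤ |π(u)| ≤ j) + Σ_{C : u ∈ C, C ∩ A = ∅} μ_w(cluster(u) = C) · Φ_j(w ∖ C) ≤ Φ_j(w)`
— a one-step supermartingale property of the champion lightness under deletion of the observer's relay-free
cluster.  Dropping the sum gives the cumulative isolation lemma. [this work] -/
def PhiSuperharmonic : Prop :=
  ∀ (n : ℕ) (w : Sym2 (Fin n) → unitInterval) (A : Finset (Fin n)) (u : Fin n) (j : ℕ) (hA : A.Nonempty),
    u ∉ A →
      (prodBernoulli w).real {ω : BondConfig (Fin n) |
          1 ≤ (A.filter fun x => ω ∈ openConn u x).card ∧ (A.filter fun x => ω ∈ openConn u x).card ≤ j} +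
        ∑ C ∈ (Finset.univ : Finset (Finset (Fin n))).filter (fun C => u ∈ C ∧ Disjoint C A),
          (prodBernoulli w).real (clusterEq u C) * phi (restrictWeights w C) A hA j
      ≤ phi w A hA j

end Summit.CriticalPhenomena.PercolationContinuityZ3.Theorems

end
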